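import Mathlib
import Summits.QuantumFields.QCD.Theorems.QuarksAsStableActionUnquenchedChessboardBoundStubMarginalRPPSD
import Literature.MathematicalPhysics.QuantumFieldTheory.WilsonSiteRPForm
import HarnessLib

/-!
# Regularity and locality of the Gram features; the polarised shared-block identity (stub
`stub_marginalRP` of crux stmt-QuantumFields-9735, line Sketch — helper file 7)

* Continuity in the gauge field of the chiral antiperiodic Wilson–Dirac matrix
  (`continuous_wdc_apLift`), of the upper block, the plane block, their row-replacement minors
  `ρ` and minors `Γ`, hence of the Gram features and of the Gram kernel of helper files 5–6;
* locality: the upper block depends only on the links of the closed positive-time half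
  `sitePosEdges ∪ sharedEdges`, the plane block (hence the kernel) only on the shared links
  (`dependsOn_upperBlock`, `dependsOn_planeBlock`);
* **the polarised shared-block identity** `integral_mul_conj_comp_eq_integral_avg` — the
  two-observable form of the tree's `LatticeRP.integral_splice_mul_conj_comp_of_shared` (same
  proof): `∫ Φ(U) conj Ψ(ΘU) dμ = ∫ χ_Φ conj χ_Ψ dμ`, `χ_Φ(V) = ∫ Φ(splice P (V, W)) dμ(W)`.
-/

noncomputable section

open Matrix Complex Finset MeasureTheory
open Literature.MathematicalPhysics.QuantumLattice Literature.MathematicalPhysics.QuantumFieldTheory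
open Literature.Probability.LatticeModels
open scoped ComplexConjugate BigOperators

namespace Summit.QuantumFields.QCD.Theorems.UnquenchedChessboardBoundLine

/-! ## Continuity -/

section Continuity

variable {L N : ℕ} [NeZero L]

omit [NeZero L] in
/-- The chiral antiperiodic Wilson–Dirac matrix depends continuously on the `SU(N)` field. -/
theorem continuous_wdc_apLift (m : ℝ) :
    Continuous fun U : GaugeConfig 4 L (Matrix.specialUnitaryGroup (Fin N) ℂ) =>
      wilsonDiracG (unitaryFundamentalRep (Fin N) ℂ) chiralGamma (apLift U) m 1 := by
  have hlink : ∀ e : Edge 4 L, Continuous fun U : GaugeConfig 4 L (Matrix.specialUnitaryGroup (Fin N) ℂ) =>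
      ((apLift U e : Matrix.unitaryGroup (Fin N) ℂ) : Matrix (Fin N) (Fin N) ℂ) := by
    intro e
    simp_rw [coe_apLift_apply]
    split_ifs
    · exact (continuous_subtype_val.comp (continuous_apply e)).neg
    · exact continuous_subtype_val.comp (continuous_apply e)
  refine continuous_pi fun p => continuous_pi fun q => ?_
  simp only [wilsonDiracG, Matrix.of_apply]
  refine continuous_const.sub (continuous_const.mul (continuous_finsetSum _ fun μ _ => ?_))
  refine Continuous.add ?_ ?_
  · split_ifs
    · refine continuous_const.mul ?_
      simp_rw [unitaryFundamentalRep_apply]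
      exact (hlink _).matrix_elem _ _
    · exact continuous_const
  · split_ifs
    · refine continuous_const.mul ?_
      simp_rw [unitaryFundamentalRep_apply, Matrix.UnitaryGroup.inv_apply, Matrix.star_apply]
      exact ((hlink _).matrix_elem _ _).star
    · exact continuous_const

/-- The upper block is continuous in the field. -/
theorem continuous_upperBlock (m : ℝ) :
    Continuous fun U : GaugeConfig 4 L (Matrix.specialUnitaryGroup (Fin N) ℂ) => upperBlock U m :=
  continuous_matrix fun _ _ => ((continuous_wdc_apLift m).matrix_elem _ _)

/-- The plane block is continuous in the field. -/
theorem continuous_planeBlock (m : ℝ) :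
    Continuous fun U : GaugeConfig 4 L (Matrix.specialUnitaryGroup (Fin N) ℂ) => planeBlock U m := by
  refine continuous_matrix fun i j => ?_
  simp only [planeBlock, Matrix.of_apply]
  split_ifs
  · exact (continuous_wdc_apLift m).matrix_elem _ _
  · exact continuous_const

/-- `ρ` of a continuous matrix-valued map is continuous. -/
theorem continuous_rho_comp {X ι : Type*} [TopologicalSpace X] [LinearOrder ι] [Fintype ι] {A : X → Matrix ι ι ℂ}
    (hA : Continuous A) (V Z : Finset ι) : Continuous fun x => rho (A x) V Z := by
  by_cases h : V.card = Z.card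
  · simp only [rho, dif_pos h]
    refine Continuous.matrix_det (continuous_matrix fun r c => ?_)
    simp only [rowRep, Matrix.of_apply]
    split_ifs
    · exact continuous_const
    · exact hA.matrix_elem r c
  · simp only [rho, dif_neg h]
    exact continuous_const

/-- A minor of a continuous matrix-valued map is continuous. -/
theorem continuous_Gamma_comp {X ι : Type*} [TopologicalSpace X] [LinearOrder ι] [Fintype ι] {A : X → Matrix ι ι ℂ}
    (hA : Continuous A) (S T : Finset ι) : Continuous fun x => Gamma (A x) S T := by
  by_cases h : S.card = T.card
  · simp_rw [Gamma_apply_of_card_eq _ (k := T.card) h rfl]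
    exact (continuous_matrix fun a b => hA.matrix_elem _ _).matrix_det
  · simp_rw [Gamma_apply_of_card_ne _ h]
    exact continuous_const

/-- A continuous function on the (compact) configuration space is bounded. -/
theorem exists_bound_of_continuous {X E : Type*} [TopologicalSpace X] [CompactSpace X] [SeminormedAddCommGroup E]
    {f : X → E} (hf : Continuous f) : ∃ C : ℝ, ∀ x, ‖f x‖ ≤ C := by
  obtain ⟨C, hC⟩ := isCompact_univ.exists_bound_of_continuousOn hf.continuousOn
  exact ⟨C, fun x => hC x (Set.mem_univ x)⟩

end Continuity

/-! ## Locality -/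

section Locality

variable {L N : ℕ} [NeZero L] [Fact (1 < L)]

omit [NeZero L] [Fact (1 < L)] in
/-- An entry of `D'[apLift U]` only involves the links joining the two sites. -/
theorem wdc_apLift_congr {U₁ U₂ : GaugeConfig 4 L (Matrix.specialUnitaryGroup (Fin N) ℂ)} (m : ℝ)
    {p q : TorusSite 4 L × Fin N × Fin 4}
    (h0 : ∀ μ, q.1 = Site.shift p.1 μ → U₁ (p.1, μ) = U₂ (p.1, μ))
    (h1 : ∀ μ, p.1 = Site.shift q.1 μ → U₁ (q.1, μ) = U₂ (q.1, μ)) :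
    wilsonDiracG (unitaryFundamentalRep (Fin N) ℂ) chiralGamma (apLift U₁) m 1 p q =
      wilsonDiracG (unitaryFundamentalRep (Fin N) ℂ) chiralGamma (apLift U₂) m 1 p q := by
  have hap : ∀ e : Edge 4 L, U₁ e = U₂ e → apLift U₁ e = apLift U₂ e := fun e he => by
    rw [apLift_apply, apLift_apply, unitaryLift_apply, unitaryLift_apply, he]
  simp only [wilsonDiracG, Matrix.of_apply]
  congr 1
  congr 1
  refine Finset.sum_congr rfl fun μ _ => ?_
  congr 1
  · split_ifs with h
    · rw [hap _ (h0 μ h)]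
    · rfl
  · split_ifs with h
    · rw [hap _ (h1 μ h)]
    · rfl

/-- **The upper block only depends on the links of the closed positive-time half.** -/
theorem dependsOn_upperBlock (hL : Even L) (h4 : 4 ≤ L) (m : ℝ) :
    DependsOn (fun U : GaugeConfig 4 L (Matrix.specialUnitaryGroup (Fin N) ℂ) => upperBlock U m)
      ((WilsonSiteRP.sitePosEdges ∪ WilsonSiteRP.sharedEdges : Finset (Edge 4 L)) : Set (Edge 4 L)) := by
  intro U₁ U₂ hU
  have hL' := Nat.even_iff.1 hL
  ext i j
  simp only [upperBlock, Matrix.of_apply]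
  have hp := upEnum_mem (L := L) (N := N) i
  have hq := upEnum_mem (L := L) (N := N) j
  rw [mem_upIdx] at hp hq
  have hpl := tv_lt (upEnum L N i).1
  have hmem : ∀ (x : TorusSite 4 L) (μ : Fin 4), tv x ≤ L / 2 → (μ = 0 → tv x < L / 2) →
      (x, μ) ∈ ((WilsonSiteRP.sitePosEdges ∪ WilsonSiteRP.sharedEdges : Finset (Edge 4 L)) : Set (Edge 4 L)) := by
    intro x μ hx h0
    rw [Finset.coe_union, Set.mem_union, Finset.mem_coe, Finset.mem_coe, WilsonSiteRP.mem_sitePosEdges,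
      WilsonSiteRP.mem_sharedEdges]
    unfold WilsonSiteRP.IsSitePosEdge WilsonSiteRP.IsSharedEdge
    change (if μ = 0 then tv x < L / 2 else 1 ≤ tv x ∧ tv x < L / 2) ∨ μ ≠ 0 ∧ (tv x = 0 ∨ tv x = L / 2)
    by_cases hμ : μ = 0
    · exact Or.inl (by rw [if_pos hμ]; exact h0 hμ)
    · rw [if_neg hμ]
      by_cases h' : tv x = 0 ∨ tv x = L / 2
      · exact Or.inr ⟨hμ, h'⟩
      · left; omega
  refine wdc_apLift_congr m (fun μ h => hU _ (hmem _ μ (by omega) fun hμ => ?_))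
    (fun μ h => hU _ (hmem _ μ (by rw [piMap_fst]; omega) fun hμ => ?_))
  · subst hμ
    have := congrArg tv h
    rw [piMap_fst, tv_shift_zero] at this
    split_ifs at this <;> omega
  · subst hμ
    have := congrArg tv h
    rw [piMap_fst, tv_shift_zero] at this
    rw [piMap_fst]
    split_ifs at this <;> omega

/-- **The plane block only depends on the shared links** (spatial links in the two planes). -/
theorem dependsOn_planeBlock (hL : Even L) (h4 : 4 ≤ L) (m : ℝ) :
    DependsOn (fun U : GaugeConfig 4 L (Matrix.specialUnitaryGroup (Fin N) ℂ) => planeBlock U m)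
      ((WilsonSiteRP.sharedEdges : Finset (Edge 4 L)) : Set (Edge 4 L)) := by
  intro U₁ U₂ hU
  have hL' := Nat.even_iff.1 hL
  ext i j
  simp only [planeBlock, Matrix.of_apply]
  split_ifs with hpl
  · rw [mem_planeIdx, mem_planeIdx] at hpl
    have hmem : ∀ (x : TorusSite 4 L) (μ : Fin 4), (tv x = 0 ∨ tv x = L / 2) → μ ≠ 0 →
        (x, μ) ∈ ((WilsonSiteRP.sharedEdges : Finset (Edge 4 L)) : Set (Edge 4 L)) := by
      intro x μ hx hμ
      rw [Finset.mem_coe, WilsonSiteRP.mem_sharedEdges]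
      exact ⟨hμ, hx⟩
    refine wdc_apLift_congr m (fun μ h => hU _ (hmem _ μ hpl.1 fun hμ => ?_))
      (fun μ h => hU _ (hmem _ μ hpl.2 fun hμ => ?_))
    · subst hμ
      have := congrArg tv h
      rw [tv_shift_zero] at this
      split_ifs at this <;> omega
    · subst hμ
      have := congrArg tv h
      rw [tv_shift_zero] at this
      split_ifs at this <;> omega
  · rfl

end Locality

/-! ## The polarised shared-block identity -/

section Polar

open Literature.MathematicalPhysics.QuantumFieldTheory.LatticeRP

/-- **Polarised shared-block identity** (two-observable form of the tree's
`LatticeRP.integral_splice_mul_conj_comp_of_shared`, same proof). Let `Θ` preserve the product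
probability measure `μ`, fix the `M`-coordinates, and let the `P`-coordinates of `Θ U` depend only on
`U` off `P`, `M ∩ P = ∅`. Then for bounded measurable `Φ, Ψ` depending only on `P ∪ M`,
`∫ Φ(U) conj Ψ(Θ U) dμ = ∫ χ_Φ conj χ_Ψ dμ` with `χ_Φ(V) = ∫ Φ(splice P (V, W)) dμ(W)`. -/
theorem integral_mul_conj_comp_eq_integral_avg {ι : Type*} [Fintype ι] [DecidableEq ι] {G : Type*}
    [MeasurableSpace G] (μ₀ : Measure G) [IsProbabilityMeasure μ₀]
    (M P : Finset ι) (Θ : (ι → G) → (ι → G)) (hΘ : MeasurePreserving Θ (piMeasure μ₀) (piMeasure μ₀))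
    (hΘM : ∀ U, ∀ i ∈ M, Θ U i = U i)
    (hΘdep : ∀ e ∈ P, DependsOn (fun U => Θ U e) ((Pᶜ : Finset ι) : Set ι)) (hMP : Disjoint M P)
    {Φ Ψ : (ι → G) → ℂ} (hΦm : Measurable Φ) (hΨm : Measurable Ψ) {K : ℝ} (hΦb : ∀ U, ‖Φ U‖ ≤ K)
    (hΨb : ∀ U, ‖Ψ U‖ ≤ K) (hΦdep : DependsOn Φ ((P ∪ M : Finset ι) : Set ι))
    (hΨdep : DependsOn Ψ ((P ∪ M : Finset ι) : Set ι)) :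
    ∫ U, Φ U * conj (Ψ (Θ U)) ∂(piMeasure μ₀) =
      ∫ V, (∫ W, Φ (splice P (V, W)) ∂(piMeasure μ₀)) * conj (∫ W, Ψ (splice P (V, W)) ∂(piMeasure μ₀))
        ∂(piMeasure μ₀) := by
  set μ : Measure (ι → G) := piMeasure μ₀ with hμ
  have hΘm : Measurable Θ := hΘ.measurable
  have hconj : Measurable (starRingEnd ℂ : ℂ → ℂ) := Complex.continuous_conj.measurable
  set ψ : (ι → G) → ℂ := fun V => ∫ W, Φ (splice P (V, W)) ∂μ with hψ
  set χ : (ι → G) → ℂ := fun V => ∫ W, Ψ (splice P (V, W)) ∂μ with hχ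
  have hψm : Measurable ψ := measurable_integral_parametric (hΦm.comp (measurable_splice P))
  have hχm : Measurable χ := measurable_integral_parametric (hΨm.comp (measurable_splice P))
  have hψb : ∀ V, ‖ψ V‖ ≤ K := fun V => norm_integral_le_of_norm_le_prob fun W => hΦb _
  have hχb : ∀ V, ‖χ V‖ ≤ K := fun V => norm_integral_le_of_norm_le_prob fun W => hΨb _
  -- the averages depend on `M` only
  have hdepM : ∀ {Ξ : (ι → G) → ℂ}, DependsOn Ξ ((P ∪ M : Finset ι) : Set ι) →
      DependsOn (fun V => ∫ W, Ξ (splice P (V, W)) ∂μ) ((M : Finset ι) : Set ι) := by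
    intro Ξ hΞ V V' hVV'
    refine integral_congr_ae (ae_of_all _ fun W => hΞ fun i hi => ?_)
    simp only [splice_apply]
    split_ifs with hP
    · rfl
    · have hiM : i ∈ M := by
        rcases Finset.mem_union.1 (Finset.mem_coe.1 hi) with h | h
        · exact absurd h hP
        · exact h
      exact hVV' i (Finset.mem_coe.2 hiM)
  have hψdep : DependsOn ψ ((M : Finset ι) : Set ι) := hdepM hΦdep
  have hχdep : DependsOn χ ((M : Finset ι) : Set ι) := hdepM hΨdep
  have hΨΘdep : DependsOn (fun U => conj (Ψ (Θ U))) ((Pᶜ : Finset ι) : Set ι) := fun U V hUV =>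
    congrArg conj (dependsOn_comp_of_shared P ∅ M Θ (by simpa using hΨdep) hΘM (by simpa using hΘdep) hMP hUV)
  -- Step A: integrate out the `P`-coordinates of the first factor
  have stepA : ∫ U, Φ U * conj (Ψ (Θ U)) ∂μ = ∫ V, conj (Ψ (Θ V)) * ψ V ∂μ := by
    have hFm : Measurable fun U => Φ U * conj (Ψ (Θ U)) := hΦm.mul (hconj.comp (hΨm.comp hΘm))
    rw [← integral_comp_eq_of_measurePreserving (measurePreserving_splice μ₀ P) hFm]
    have hGi : Integrable (fun q : (ι → G) × (ι → G) => Φ (splice P q) * conj (Ψ (Θ (splice P q)))) (μ.prod μ) :=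
      integrable_of_norm_le (hFm.comp (measurable_splice P)) (K := K * K) fun q => by
        rw [norm_mul, Complex.norm_conj]
        exact mul_le_mul (hΦb _) (hΨb _) (norm_nonneg _) ((norm_nonneg _).trans (hΦb (splice P q)))
    rw [integral_prod _ hGi]
    refine integral_congr_ae (ae_of_all _ fun V => ?_)
    have hΘV : ∀ W, conj (Ψ (Θ (splice P (V, W)))) = conj (Ψ (Θ V)) := fun W =>
      apply_splice_of_dependsOn_compl hΨΘdep V W
    simp_rw [hΘV]
    rw [integral_mul_const, mul_comm]
  -- Step B: `Θ`-invariance moves the reflection onto the other factor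
  have stepB : ∫ V, conj (Ψ (Θ V)) * ψ V ∂μ = ∫ V, conj (Ψ V) * ψ V ∂μ := by
    have h1 : ∀ V, ψ V = ψ (Θ V) := fun V => hψdep fun i hi => (hΘM V i (Finset.mem_coe.1 hi)).symm
    calc ∫ V, conj (Ψ (Θ V)) * ψ V ∂μ = ∫ V, conj (Ψ (Θ V)) * ψ (Θ V) ∂μ := by simp_rw [← h1]
      _ = ∫ V, conj (Ψ V) * ψ V ∂μ := integral_comp_eq_of_measurePreserving hΘ ((hconj.comp hΨm).mul hψm)
  -- Step C: integrate out the `P`-coordinates of the reflected factor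
  have stepC : ∫ V, conj (Ψ V) * ψ V ∂μ = ∫ V, ψ V * conj (χ V) ∂μ := by
    have hFm : Measurable fun V => conj (Ψ V) * ψ V := (hconj.comp hΨm).mul hψm
    rw [← integral_comp_eq_of_measurePreserving (measurePreserving_splice μ₀ P) hFm]
    have hGi : Integrable (fun q : (ι → G) × (ι → G) => conj (Ψ (splice P q)) * ψ (splice P q)) (μ.prod μ) :=
      integrable_of_norm_le (hFm.comp (measurable_splice P)) (K := K * K) fun q => by
        rw [norm_mul, Complex.norm_conj]
        exact mul_le_mul (hΨb _) (hψb _) (norm_nonneg _) ((norm_nonneg _).trans (hΨb (splice P q)))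
    rw [integral_prod _ hGi]
    refine integral_congr_ae (ae_of_all _ fun V => ?_)
    have hψV : ∀ W, ψ (splice P (V, W)) = ψ V := fun W => apply_splice_of_dependsOn_of_disjoint hψdep hMP V W
    simp only
    simp_rw [hψV]
    rw [integral_mul_const, ← integral_conj, mul_comm]
  rw [stepA, stepB, stepC]

end Polar

end Summit.QuantumFields.QCD.Theorems.UnquenchedChessboardBoundLine

end
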